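import Summits.AtomisticToContinuum.HydrodynamicLimit.Theorems.OneFlightGossipEngineClampedTransferDockBridgeDefs
import HarnessLib

/-!
# The bridge, domination half — pathwise split and one window in mean (line `Sketch`, crux `ClampedTransferDock`, stmt-AtomisticToContinuum-16665)

Support file (`--supports stmt-AtomisticToContinuum-16665`; registered support signature `driftBad_mono`) for the registered stub
`stub_bridgeDomination` (file `…ClampedTransferDockStubBridgeDomination.lean`): PATHWISE on the good set, per particle and per instant of
the window, `1{1<‖W‖}‖W‖³ ≤ 8·1{M<‖v‖}‖v‖³ + K³·1{DriftBad_{u_s}} + [Y-integrand]` (`W = v − u_s(x)`, `‖u_s‖ ≤ U ≤ M`, `K = M + U`),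
integrated over `[s, s+w]` and summed (`pathwise_window_bound`); IN MEAN, Tonelli over the window for the two measurable terms (cubic
tails per instant, drift counts per instant — `driftCount_window_le`, with the field shift `lintegral_driftCount_le_of_shift`), the
possibly non-measurable coherent bounded term integrated last (`oneWindow_mean`). Lead prover-line-stmt-AtomisticToContinuum-16665-0.
-/

noncomputable section

namespace Summit.AtomisticToContinuum.HydrodynamicLimit.Theorems.ClampedTransferDockBridge

open scoped BigOperators ENNReal Classical Interval
open MeasureTheory Filter Set Topology InformationTheory
open Literature.MathematicalPhysics.KineticTheory Literature.Analysis.FluidPDE Literature.Analysis.FunctionSpaces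
open Summit.AtomisticToContinuum.HydrodynamicLimit.Theses
open Summit.AtomisticToContinuum.HydrodynamicLimit.Theorems
open Summit.AtomisticToContinuum.HydrodynamicLimit.Theorems.ClampedCurrentsDockCubicChannelPrelim
open Summit.AtomisticToContinuum.HydrodynamicLimit.Theorems.ClampedCurrentsDockCubicChannel (Wv norm_sub_cube_le_four)
open Summit.AtomisticToContinuum.HydrodynamicLimit.Theorems.HydroLimitInBandContinuity (measurable_flow_of_mem)
open Summit.AtomisticToContinuum.HydrodynamicLimit.Theorems.EntropyClockDock (ae_mem_good_localGibbsLaw)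
open Summit.AtomisticToContinuum.HydrodynamicLimit.Theorems.ClampedCurrentsDockCubicPathwise (intervalIntegrable_orbit)

variable {N : ℕ}

/-! ## §1 Pointwise inequalities -/

/-- **Monotonicity of the drift test in the field**: moving the reference field by at most `D₀ − D₀′` in sup norm turns a
drift-bad particle at level `D₀` into a drift-bad particle at level `D₀′` (same configuration, same scales) — registered support signature of line Sketch, crux ClampedTransferDock. [folklore] -/
theorem driftBad_mono {κ r₀ D₀ D₀' : ℝ} {u u' : T3 → V3} (h : ∀ x, ‖u x - u' x‖ ≤ D₀ - D₀')
    {c : Config (N + 1) (Fin 3) T3} {i : Fin (N + 1)} (hD : DriftBad κ r₀ D₀ u c i) : DriftBad κ r₀ D₀' u' c i := by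
  obtain ⟨k, hk, hlt⟩ := hD
  refine ⟨k, hk, ?_⟩
  have htri := norm_sub_le_norm_sub_add_norm_sub
    (ballMeanVel (κ * ((N : ℝ) + 1) ^ (-(1 / 3 : ℝ)) * 2 ^ k) c i) (u' (c i).1) (u (c i).1)
  have hsym : ‖u' (c i).1 - u (c i).1‖ = ‖u (c i).1 - u' (c i).1‖ := norm_sub_rev _ _
  linarith [h (c i).1]

/-- The drift indicator is monotone under `driftBad_mono`. [folklore] -/
theorem driftBad_indicator_mono {κ r₀ D₀ D₀' : ℝ} {u u' : T3 → V3} (h : ∀ x, ‖u x - u' x‖ ≤ D₀ - D₀')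
    (c : Config (N + 1) (Fin 3) T3) (i : Fin (N + 1)) :
    (if DriftBad κ r₀ D₀ u c i then (1 : ℝ) else 0) ≤ (if DriftBad κ r₀ D₀' u' c i then (1 : ℝ) else 0) := by
  by_cases hD : DriftBad κ r₀ D₀ u c i
  · rw [if_pos hD, if_pos (driftBad_mono h hD)]
  · rw [if_neg hD]
    split_ifs <;> norm_num

/-- **The pointwise split of the sharp suprathermal content at `K⋆ = 1`.** For `‖a‖ ≤ U ≤ M`, `K = M + U`, and any
proposition `P` (the drift test): `1{1<‖v−a‖}‖v−a‖³ ≤ 8·1{M<‖v‖}‖v‖³ + K³·1{P} + 1{1<‖v−a‖ ≤ K ∧ ¬P}‖v−a‖³` — speeds above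
`K` go to the cubic tail (`‖v‖ > M`, `‖v−a‖ ≤ 2‖v‖`), speeds in `(1, K]` are either drift-bad (bounded by `K³`) or counted. [folklore] -/
theorem cubeHi_le_split {v a : V3} {U M K : ℝ} (hU : 0 ≤ U) (ha : ‖a‖ ≤ U) (hUM : U ≤ M) (hK : K = M + U)
    (P : Prop) [Decidable P] :
    (if 1 < ‖v - a‖ then ‖v - a‖ ^ 3 else 0) ≤
      8 * Set.indicator {w : V3 | M < ‖w‖} (fun w => ‖w‖ ^ 3) v + K ^ 3 * (if P then (1 : ℝ) else 0) +
        (if 1 < ‖v - a‖ ∧ ‖v - a‖ ≤ K ∧ ¬ P then ‖v - a‖ ^ 3 else 0) := by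
  have hI0 : 0 ≤ Set.indicator {w : V3 | M < ‖w‖} (fun w => ‖w‖ ^ 3) v :=
    Set.indicator_nonneg (fun _ _ => by positivity) _
  have hK0 : 0 ≤ K := by rw [hK]; linarith
  have hP0 : 0 ≤ K ^ 3 * (if P then (1 : ℝ) else 0) := by split_ifs <;> positivity
  have hT0 : 0 ≤ (if 1 < ‖v - a‖ ∧ ‖v - a‖ ≤ K ∧ ¬ P then ‖v - a‖ ^ 3 else 0) := by split_ifs <;> positivity
  by_cases h1 : 1 < ‖v - a‖
  · rw [if_pos h1]
    rcases le_or_gt ‖v - a‖ K with hle | hgt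
    · by_cases hP : P
      · have h3 : ‖v - a‖ ^ 3 ≤ K ^ 3 := pow_le_pow_left₀ (norm_nonneg _) hle 3
        rw [if_pos hP, mul_one]
        linarith
      · rw [if_pos (show 1 < ‖v - a‖ ∧ ‖v - a‖ ≤ K ∧ ¬ P from ⟨h1, hle, hP⟩)]
        linarith
    · -- above `K`: the cubic tail
      have hva : ‖v - a‖ ≤ ‖v‖ + ‖a‖ := norm_sub_le v a
      have hv : M < ‖v‖ := by rw [hK] at hgt; linarith
      rw [Set.indicator_of_mem (show v ∈ {w : V3 | M < ‖w‖} from hv)]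
      have h2 : ‖v - a‖ ≤ 2 * ‖v‖ := by linarith
      have h3 : ‖v - a‖ ^ 3 ≤ (2 * ‖v‖) ^ 3 := pow_le_pow_left₀ (norm_nonneg _) h2 3
      nlinarith [h3, hP0, hT0, pow_nonneg (norm_nonneg v) 3]
  · rw [if_neg h1]
    linarith

/-! ## §2 Along a good orbit: the pathwise window bound -/

variable {σ : ℝ}

/-- A measurable configuration functional bounded by a constant, read along a good orbit, is interval integrable on every
bounded interval. [folklore] -/
theorem intervalIntegrable_cfg_of_bound (Φ : HardSphereFlow (Torus.geometry (Fin 3)) (hsDiameter σ N) (N + 1))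
    {z : Config (N + 1) (Fin 3) T3} (hz : z ∈ Φ.good) {f : Config (N + 1) (Fin 3) T3 → ℝ} (hf : Measurable f)
    {B : ℝ} (hB : ∀ c, |f c| ≤ B) (a b : ℝ) : IntervalIntegrable (fun r => f (Φ.flow r z)) volume a b := by
  have hm : Measurable fun r => f (Φ.flow r z) := hf.comp (measurable_flow_of_mem Φ hz)
  exact (IntegrableOn.of_bound isCompact_uIcc.measure_lt_top hm.aestronglyMeasurable B
    (ae_of_all _ fun r => by rw [Real.norm_eq_abs]; exact hB _)).intervalIntegrable

/-- The sharp suprathermal integrand `1{1<‖W_i(r)‖}‖W_i(r)‖³` is interval integrable along a good orbit. [folklore] -/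
theorem intervalIntegrable_cubeHi (Φ : HardSphereFlow (Torus.geometry (Fin 3)) (hsDiameter σ N) (N + 1))
    {z : Config (N + 1) (Fin 3) T3} (hz : z ∈ Φ.good) {us : T3 → V3} (hus : Continuous us) {U : ℝ} (hU : 0 ≤ U)
    (hule : ∀ x, ‖us x‖ ≤ U) (i : Fin (N + 1)) (a b : ℝ) :
    IntervalIntegrable (fun r => if 1 < ‖Wv Φ us z i r‖ then ‖Wv Φ us z i r‖ ^ 3 else 0) volume a b := by
  have hdom := intervalIntegrable_orbit Φ hz (F := fun y : T3 × V3 => 4 * (‖y.2‖ ^ 3 + U ^ 3)) (by fun_prop) i a b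
  refine hdom.mono_fun ?_ (Eventually.of_forall fun r => ?_)
  · have hF : Measurable fun y : T3 × V3 => if 1 < ‖y.2 - us y.1‖ then ‖y.2 - us y.1‖ ^ 3 else 0 := by
      have hc : Continuous fun y : T3 × V3 => ‖y.2 - us y.1‖ := by fun_prop
      exact Measurable.ite (measurableSet_lt measurable_const hc.measurable) (hc.measurable.pow_const 3)
        measurable_const
    exact (hF.comp ((measurable_pi_apply i).comp (measurable_flow_of_mem Φ hz))).aestronglyMeasurable
  · have h4 := norm_sub_cube_le_four (v := (Φ.flow r z i).2) hU (hule (Φ.flow r z i).1)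
    have h0 : 0 ≤ ‖Wv Φ us z i r‖ ^ 3 := by positivity
    have hnn : 0 ≤ (if 1 < ‖Wv Φ us z i r‖ then ‖Wv Φ us z i r‖ ^ 3 else 0) := by split_ifs <;> positivity
    show ‖(if 1 < ‖Wv Φ us z i r‖ then ‖Wv Φ us z i r‖ ^ 3 else 0)‖ ≤ ‖4 * (‖(Φ.flow r z i).2‖ ^ 3 + U ^ 3)‖
    rw [Real.norm_of_nonneg hnn, Real.norm_of_nonneg (by positivity)]
    split_ifs
    · exact h4
    · exact h0.trans h4

/-- **The pathwise window bound.** On the good set, for a frozen field `us` with `‖us‖ ≤ U ≤ M`, `K = M + U`, the particle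
average of the coherent sharp suprathermal content (ANY coherence predicate) is at most `8/(w(N+1))` times the window integral
of the cubic tail sum at level `M`, plus `K³/(w(N+1))` times the window integral of the drift-bad count, plus the particle
average of the coherent bounded non-blob content. [folklore] -/
theorem pathwise_window_bound (Φ : HardSphereFlow (Torus.geometry (Fin 3)) (hsDiameter σ N) (N + 1))
    {z : Config (N + 1) (Fin 3) T3} (hz : z ∈ Φ.good) {us : T3 → V3} (hus : Continuous us)
    {U M K κ r₀ D₀ s w : ℝ} (hU : 0 ≤ U) (hule : ∀ x, ‖us x‖ ≤ U) (hUM : U ≤ M) (hK : K = M + U) (hw : 0 < w)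
    (coh : Fin (N + 1) → Prop) :
    ((N : ℝ) + 1)⁻¹ * ∑ i : Fin (N + 1), (if coh i then
        w⁻¹ * ∫ r in s..(s + w), (if 1 < ‖Wv Φ us z i r‖ then ‖Wv Φ us z i r‖ ^ 3 else 0) else 0) ≤
      8 * (w * ((N : ℝ) + 1))⁻¹ * (∫ r in s..(s + w), tailSum N M (Φ.flow r z)) +
        K ^ 3 * (w * ((N : ℝ) + 1))⁻¹ *
          (∫ r in s..(s + w), ∑ i : Fin (N + 1), (if DriftBad κ r₀ D₀ us (Φ.flow r z) i then (1 : ℝ) else 0)) +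
        ((N : ℝ) + 1)⁻¹ * ∑ i : Fin (N + 1), (if coh i then
          w⁻¹ * ∫ r in s..(s + w), (if 1 < ‖Wv Φ us z i r‖ ∧ ‖Wv Φ us z i r‖ ≤ K ∧ ¬ DriftBad κ r₀ D₀ us (Φ.flow r z) i
            then ‖Wv Φ us z i r‖ ^ 3 else 0) else 0) := by
  have hsw : s ≤ s + w := by linarith
  have hN : (0 : ℝ) < (N : ℝ) + 1 := by positivity
  have hK0 : 0 ≤ K := by rw [hK]; linarith
  -- the three integrands per particle
  set Hi : Fin (N + 1) → ℝ → ℝ := fun i r => if 1 < ‖Wv Φ us z i r‖ then ‖Wv Φ us z i r‖ ^ 3 else 0 with hHi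
  set Tl : Fin (N + 1) → ℝ → ℝ := fun i r => Set.indicator {v : V3 | M < ‖v‖} (fun v => ‖v‖ ^ 3) (Φ.flow r z i).2
    with hTl
  set Db : Fin (N + 1) → ℝ → ℝ := fun i r => if DriftBad κ r₀ D₀ us (Φ.flow r z) i then (1 : ℝ) else 0 with hDb
  set Yi : Fin (N + 1) → ℝ → ℝ := fun i r =>
    if 1 < ‖Wv Φ us z i r‖ ∧ ‖Wv Φ us z i r‖ ≤ K ∧ ¬ DriftBad κ r₀ D₀ us (Φ.flow r z) i then ‖Wv Φ us z i r‖ ^ 3 else 0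
    with hYi
  -- interval integrability
  have hHii : ∀ i, IntervalIntegrable (Hi i) volume s (s + w) := fun i =>
    intervalIntegrable_cubeHi Φ hz hus hU hule i s (s + w)
  have hv3i : ∀ i, IntervalIntegrable (fun r => ‖(Φ.flow r z i).2‖ ^ 3) volume s (s + w) := fun i =>
    intervalIntegrable_orbit Φ hz (F := fun y : T3 × V3 => ‖y.2‖ ^ 3) (by fun_prop) i s (s + w)
  have hTli : ∀ i, IntervalIntegrable (Tl i) volume s (s + w) := by
    intro i
    refine (hv3i i).mono_fun ?_ (Eventually.of_forall fun r => ?_)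
    · exact ((((measurable_norm.pow_const 3).indicator (measurableSet_lt measurable_const measurable_norm)).comp
        ((measurable_pi_apply i).comp (measurable_flow_of_mem Φ hz)).snd)).aestronglyMeasurable
    · show ‖Set.indicator {v : V3 | M < ‖v‖} (fun v => ‖v‖ ^ 3) (Φ.flow r z i).2‖ ≤ ‖‖(Φ.flow r z i).2‖ ^ 3‖
      rw [Real.norm_of_nonneg (Set.indicator_nonneg (fun _ _ => by positivity) _), Real.norm_of_nonneg (by positivity)]
      exact Set.indicator_le_self' (fun _ _ => by positivity) _
  have hDbi : ∀ i, IntervalIntegrable (Db i) volume s (s + w) := by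
    intro i
    refine intervalIntegrable_cfg_of_bound Φ hz (f := fun c => if DriftBad κ r₀ D₀ us c i then (1 : ℝ) else 0)
      (Measurable.ite (measurableSet_driftBad κ r₀ D₀ hus i) measurable_const measurable_const) (B := 1)
      (fun c => ?_) s (s + w)
    split_ifs <;> norm_num
  have hYii : ∀ i, IntervalIntegrable (Yi i) volume s (s + w) := by
    intro i
    have hW : Measurable fun c : Config (N + 1) (Fin 3) T3 => ‖(c i).2 - us (c i).1‖ :=
      ((measurable_pi_apply i).snd.sub (hus.measurable.comp (measurable_pi_apply i).fst)).norm
    have hA : Measurable fun c : Config (N + 1) (Fin 3) T3 => 1 < ‖(c i).2 - us (c i).1‖ :=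
      measurableSet_setOf.1 (measurableSet_lt measurable_const hW)
    have hB : Measurable fun c : Config (N + 1) (Fin 3) T3 => ‖(c i).2 - us (c i).1‖ ≤ K :=
      measurableSet_setOf.1 (measurableSet_le hW measurable_const)
    have hD : Measurable fun c : Config (N + 1) (Fin 3) T3 => DriftBad κ r₀ D₀ us c i :=
      measurableSet_setOf.1 (measurableSet_driftBad κ r₀ D₀ hus i)
    have hS : MeasurableSet {c : Config (N + 1) (Fin 3) T3 |
        1 < ‖(c i).2 - us (c i).1‖ ∧ ‖(c i).2 - us (c i).1‖ ≤ K ∧ ¬ DriftBad κ r₀ D₀ us c i} :=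
      measurableSet_setOf.2 (hA.and (hB.and hD.not))
    refine intervalIntegrable_cfg_of_bound Φ hz
      (f := fun c => if 1 < ‖(c i).2 - us (c i).1‖ ∧ ‖(c i).2 - us (c i).1‖ ≤ K ∧ ¬ DriftBad κ r₀ D₀ us c i
        then ‖(c i).2 - us (c i).1‖ ^ 3 else 0)
      (Measurable.ite hS (hW.pow_const 3) measurable_const) (B := K ^ 3) (fun c => ?_) s (s + w)
    split_ifs with h
    · rw [abs_of_nonneg (by positivity)]
      exact pow_le_pow_left₀ (norm_nonneg _) h.2.1 3
    · rw [abs_zero]; positivity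
  -- nonnegativity
  have hTl0 : ∀ i, 0 ≤ ∫ r in s..(s + w), Tl i r := fun i =>
    intervalIntegral.integral_nonneg hsw fun r _ => Set.indicator_nonneg (fun _ _ => by positivity) _
  have hDb0 : ∀ i, 0 ≤ ∫ r in s..(s + w), Db i r := fun i =>
    intervalIntegral.integral_nonneg hsw fun r _ => by simp only [hDb]; split_ifs <;> norm_num
  have hYi0 : ∀ i, 0 ≤ ∫ r in s..(s + w), Yi i r := fun i =>
    intervalIntegral.integral_nonneg hsw fun r _ => by simp only [hYi]; split_ifs <;> positivity
  -- per particle: the split integrated over the window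
  have hsplit : ∀ i, ∫ r in s..(s + w), Hi i r ≤
      8 * (∫ r in s..(s + w), Tl i r) + K ^ 3 * (∫ r in s..(s + w), Db i r) + ∫ r in s..(s + w), Yi i r := by
    intro i
    calc ∫ r in s..(s + w), Hi i r ≤ ∫ r in s..(s + w), (8 * Tl i r + K ^ 3 * Db i r + Yi i r) :=
          intervalIntegral.integral_mono_on hsw (hHii i)
            ((((hTli i).const_mul 8).add ((hDbi i).const_mul (K ^ 3))).add (hYii i)) fun r _ =>
            cubeHi_le_split hU (hule _) hUM hK (DriftBad κ r₀ D₀ us (Φ.flow r z) i)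
      _ = 8 * (∫ r in s..(s + w), Tl i r) + K ^ 3 * (∫ r in s..(s + w), Db i r) + ∫ r in s..(s + w), Yi i r := by
          rw [intervalIntegral.integral_add (((hTli i).const_mul 8).add ((hDbi i).const_mul (K ^ 3))) (hYii i),
            intervalIntegral.integral_add ((hTli i).const_mul 8) ((hDbi i).const_mul (K ^ 3)),
            intervalIntegral.integral_const_mul, intervalIntegral.integral_const_mul]
  -- per particle: the coherent sharp content against the three terms
  have hwi : 0 < w⁻¹ := inv_pos.2 hw
  have hterm : ∀ i, (if coh i then w⁻¹ * ∫ r in s..(s + w), Hi i r else 0) ≤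
      w⁻¹ * (8 * (∫ r in s..(s + w), Tl i r) + K ^ 3 * (∫ r in s..(s + w), Db i r)) +
        (if coh i then w⁻¹ * ∫ r in s..(s + w), Yi i r else 0) := by
    intro i
    have hA0 : 0 ≤ w⁻¹ * (8 * (∫ r in s..(s + w), Tl i r) + K ^ 3 * (∫ r in s..(s + w), Db i r)) :=
      mul_nonneg hwi.le (add_nonneg (mul_nonneg (by norm_num) (hTl0 i)) (mul_nonneg (pow_nonneg hK0 3) (hDb0 i)))
    split_ifs with hc
    · have h := mul_le_mul_of_nonneg_left (hsplit i) hwi.le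
      rw [mul_add] at h
      exact h
    · linarith [mul_nonneg hwi.le (hYi0 i)]
  -- sums over particles
  have hTsum : ∑ i, ∫ r in s..(s + w), Tl i r = ∫ r in s..(s + w), tailSum N M (Φ.flow r z) := by
    rw [← intervalIntegral.integral_finsetSum fun i _ => hTli i]
    rfl
  have hDsum : ∑ i, ∫ r in s..(s + w), Db i r =
      ∫ r in s..(s + w), ∑ i : Fin (N + 1), (if DriftBad κ r₀ D₀ us (Φ.flow r z) i then (1 : ℝ) else 0) := by
    rw [← intervalIntegral.integral_finsetSum fun i _ => hDbi i]
  calc ((N : ℝ) + 1)⁻¹ * ∑ i : Fin (N + 1), (if coh i then w⁻¹ * ∫ r in s..(s + w), Hi i r else 0)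
      ≤ ((N : ℝ) + 1)⁻¹ * ∑ i : Fin (N + 1),
          (w⁻¹ * (8 * (∫ r in s..(s + w), Tl i r) + K ^ 3 * (∫ r in s..(s + w), Db i r)) +
            (if coh i then w⁻¹ * ∫ r in s..(s + w), Yi i r else 0)) :=
        mul_le_mul_of_nonneg_left (Finset.sum_le_sum fun i _ => hterm i) (inv_nonneg.2 hN.le)
    _ = 8 * (w * ((N : ℝ) + 1))⁻¹ * (∑ i, ∫ r in s..(s + w), Tl i r) +
          K ^ 3 * (w * ((N : ℝ) + 1))⁻¹ * (∑ i, ∫ r in s..(s + w), Db i r) +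
          ((N : ℝ) + 1)⁻¹ * ∑ i : Fin (N + 1), (if coh i then w⁻¹ * ∫ r in s..(s + w), Yi i r else 0) := by
        rw [Finset.sum_add_distrib, ← Finset.mul_sum, Finset.sum_add_distrib, ← Finset.mul_sum, ← Finset.mul_sum,
          mul_inv]
        ring
    _ = _ := by rw [hTsum, hDsum]

/-! ## §3 In mean over one window -/

variable {a₀ θ₀ : T3 → ℝ} {u₀ : T3 → V3}

/-- **Drift counts over a window (Tonelli).** Per-instant bounds `E_λ[Σ_i 1{DriftBad}(Φ_r ·)] ≤ (N+1)e` on `[s, s+w]` give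
`E_λ[∫_s^{s+w} Σ_i 1{DriftBad}(Φ_r ·) dr] ≤ w (N+1) e` (the drift count is a bounded measurable configuration functional). [folklore] -/
theorem driftCount_window_le (hσ2 : σ ≤ 1 / 2) (ha : Continuous a₀) (hθ : Continuous θ₀) (hu : Continuous u₀)
    (ha0 : ∀ x, 0 < a₀ x) (hθ0 : ∀ x, 0 < θ₀ x)
    (Φ : HardSphereFlow (Torus.geometry (Fin 3)) (hsDiameter σ N) (N + 1)) {us : T3 → V3} (hus : Continuous us)
    {κ r₀ D₀ e s w : ℝ} (hw : 0 ≤ w)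
    (hbd : ∀ r ∈ Icc s (s + w), ∫⁻ z, ENNReal.ofReal (∑ i : Fin (N + 1),
        (if DriftBad κ r₀ D₀ us (Φ.flow r z) i then (1 : ℝ) else 0)) ∂(localGibbsLaw σ a₀ u₀ θ₀ N Φ) ≤
        ENNReal.ofReal (((N : ℝ) + 1) * e)) :
    ∫⁻ z, ENNReal.ofReal (∫ r in s..(s + w), ∑ i : Fin (N + 1),
        (if DriftBad κ r₀ D₀ us (Φ.flow r z) i then (1 : ℝ) else 0)) ∂(localGibbsLaw σ a₀ u₀ θ₀ N Φ) ≤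
      ENNReal.ofReal (w * (((N : ℝ) + 1) * e)) := by
  have hm : Measurable fun c : Config (N + 1) (Fin 3) T3 =>
      ∑ i : Fin (N + 1), (if DriftBad κ r₀ D₀ us c i then (1 : ℝ) else 0) :=
    Finset.measurable_sum _ fun i _ => Measurable.ite (measurableSet_driftBad κ r₀ D₀ hus i) measurable_const measurable_const
  have h0 : ∀ c : Config (N + 1) (Fin 3) T3, 0 ≤ ∑ i : Fin (N + 1), (if DriftBad κ r₀ D₀ us c i then (1 : ℝ) else 0) :=
    fun c => Finset.sum_nonneg fun i _ => by split_ifs <;> norm_num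
  have hle : ∀ c : Config (N + 1) (Fin 3) T3, ∑ i : Fin (N + 1), (if DriftBad κ r₀ D₀ us c i then (1 : ℝ) else 0) ≤ (N : ℝ) + 1 := by
    intro c
    calc ∑ i : Fin (N + 1), (if DriftBad κ r₀ D₀ us c i then (1 : ℝ) else 0) ≤ ∑ _i : Fin (N + 1), (1 : ℝ) :=
          Finset.sum_le_sum fun i _ => by split_ifs <;> norm_num
      _ = (N : ℝ) + 1 := by rw [Finset.sum_const, Finset.card_univ, Fintype.card_fin, nsmul_eq_mul, mul_one]; push_cast; ring
  have hfi : ∀ z ∈ Φ.good, ∀ a b : ℝ, IntegrableOn (fun r => ∑ i : Fin (N + 1),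
      (if DriftBad κ r₀ D₀ us (Φ.flow r z) i then (1 : ℝ) else 0)) (Ioc a b) := by
    intro z hz a b
    refine IntegrableOn.of_bound measure_Ioc_lt_top ((hm.comp (measurable_flow_of_mem Φ hz)).aestronglyMeasurable)
      ((N : ℝ) + 1) (ae_of_all _ fun r => ?_)
    rw [Real.norm_eq_abs, abs_of_nonneg (h0 _)]
    exact hle _
  exact lintegral_window_le hσ2 ha hθ hu ha0 hθ0 Φ hm h0 hfi hw hbd

/-- **Per-instant drift counts from the drift price after a field shift.** If the frozen field `us` is within `D − D′` of the
instantaneous field `ur` in sup norm, the mean count of drift-bad particles at level `D` against `us` is bounded by `(N+1)` times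
the mean fraction of drift-bad particles at level `D′` against `ur`. [folklore] -/
theorem lintegral_driftCount_le_of_shift (Φ : HardSphereFlow (Torus.geometry (Fin 3)) (hsDiameter σ N) (N + 1))
    (μ : Measure (Config (N + 1) (Fin 3) T3)) {us ur : T3 → V3} {κ r₀ D D' e : ℝ} (r : ℝ)
    (h : ∀ x, ‖us x - ur x‖ ≤ D - D')
    (hbd : ∫⁻ z, ENNReal.ofReal (((N : ℝ) + 1)⁻¹ * ∑ i : Fin (N + 1),
        (if DriftBad κ r₀ D' ur (Φ.flow r z) i then (1 : ℝ) else 0)) ∂μ ≤ ENNReal.ofReal e) :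
    ∫⁻ z, ENNReal.ofReal (∑ i : Fin (N + 1), (if DriftBad κ r₀ D us (Φ.flow r z) i then (1 : ℝ) else 0)) ∂μ ≤
      ENNReal.ofReal (((N : ℝ) + 1) * e) := by
  have hN : (0 : ℝ) < (N : ℝ) + 1 := by positivity
  have hpt : ∀ z, ENNReal.ofReal (∑ i : Fin (N + 1), (if DriftBad κ r₀ D us (Φ.flow r z) i then (1 : ℝ) else 0)) ≤
      ENNReal.ofReal ((N : ℝ) + 1) * ENNReal.ofReal (((N : ℝ) + 1)⁻¹ * ∑ i : Fin (N + 1),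
        (if DriftBad κ r₀ D' ur (Φ.flow r z) i then (1 : ℝ) else 0)) := by
    intro z
    rw [← ENNReal.ofReal_mul hN.le, ← mul_assoc, mul_inv_cancel₀ hN.ne', one_mul]
    exact ENNReal.ofReal_le_ofReal (Finset.sum_le_sum fun i _ => driftBad_indicator_mono h _ i)
  calc ∫⁻ z, ENNReal.ofReal (∑ i : Fin (N + 1), (if DriftBad κ r₀ D us (Φ.flow r z) i then (1 : ℝ) else 0)) ∂μ
      ≤ ∫⁻ z, ENNReal.ofReal ((N : ℝ) + 1) * ENNReal.ofReal (((N : ℝ) + 1)⁻¹ * ∑ i : Fin (N + 1),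
          (if DriftBad κ r₀ D' ur (Φ.flow r z) i then (1 : ℝ) else 0)) ∂μ := lintegral_mono hpt
    _ = ENNReal.ofReal ((N : ℝ) + 1) * ∫⁻ z, ENNReal.ofReal (((N : ℝ) + 1)⁻¹ * ∑ i : Fin (N + 1),
          (if DriftBad κ r₀ D' ur (Φ.flow r z) i then (1 : ℝ) else 0)) ∂μ :=
        lintegral_const_mul' _ _ ENNReal.ofReal_ne_top
    _ ≤ ENNReal.ofReal ((N : ℝ) + 1) * ENNReal.ofReal e := mul_le_mul' le_rfl hbd
    _ = ENNReal.ofReal (((N : ℝ) + 1) * e) := (ENNReal.ofReal_mul hN.le).symm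

/-- **One window in mean.** Under `λ = localGibbsLaw σ a₀ u₀ θ₀ N Φ`, with the frozen field `us` (`‖us‖ ≤ U ≤ M`, `K = M + U`) and
ANY coherence predicate: per-instant cubic tails at level `M` (accuracy `e″`), per-instant drift counts against `us` (accuracy
`(N+1)e₃`) and the mean of the coherent bounded non-blob content (accuracy `e′`) bound the mean of the coherent sharp suprathermal
content by `8e″ + K³e₃ + e′` (pathwise bound a.s.; Tonelli for the two measurable terms; the coherent term last). [folklore] -/
theorem oneWindow_mean (Φ : HardSphereFlow (Torus.geometry (Fin 3)) (hsDiameter σ N) (N + 1))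
    (hσ : 0 < σ) (hσ2 : σ < 1 / 2) (ha : Continuous a₀) (hθ : Continuous θ₀) (hu : Continuous u₀)
    (ha0 : ∀ x, 0 < a₀ x) (hθ0 : ∀ x, 0 < θ₀ x) {us : T3 → V3} (hus : Continuous us)
    {U M K κ r₀ D₀ s w e'' e₃ e' : ℝ} (hU : 0 ≤ U) (hule : ∀ x, ‖us x‖ ≤ U) (hUM : U ≤ M) (hK : K = M + U) (hw : 0 < w)
    (he'' : 0 ≤ e'') (he₃ : 0 ≤ e₃) (he' : 0 ≤ e') (coh : Fin (N + 1) → Config (N + 1) (Fin 3) T3 → Prop)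
    (hECT : ∀ r ∈ Icc s (s + w), ∫⁻ z, ENNReal.ofReal (((N : ℝ) + 1)⁻¹ * ∑ i : Fin (N + 1),
        Set.indicator {v : V3 | M < ‖v‖} (fun v => ‖v‖ ^ 3) ((Φ.flow r z i).2)) ∂(localGibbsLaw σ a₀ u₀ θ₀ N Φ) ≤
        ENNReal.ofReal e'')
    (hDB : ∀ r ∈ Icc s (s + w), ∫⁻ z, ENNReal.ofReal (∑ i : Fin (N + 1),
        (if DriftBad κ r₀ D₀ us (Φ.flow r z) i then (1 : ℝ) else 0)) ∂(localGibbsLaw σ a₀ u₀ θ₀ N Φ) ≤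
        ENNReal.ofReal (((N : ℝ) + 1) * e₃))
    (hB : ∫⁻ z, ENNReal.ofReal (((N : ℝ) + 1)⁻¹ * ∑ i : Fin (N + 1), (if coh i z then
        w⁻¹ * ∫ r in s..(s + w), (if 1 < ‖Wv Φ us z i r‖ ∧ ‖Wv Φ us z i r‖ ≤ K ∧ ¬ DriftBad κ r₀ D₀ us (Φ.flow r z) i
          then ‖Wv Φ us z i r‖ ^ 3 else 0) else 0)) ∂(localGibbsLaw σ a₀ u₀ θ₀ N Φ) ≤ ENNReal.ofReal e') :
    ∫⁻ z, ENNReal.ofReal (((N : ℝ) + 1)⁻¹ * ∑ i : Fin (N + 1), (if coh i z then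
        w⁻¹ * ∫ r in s..(s + w), (if 1 < ‖Wv Φ us z i r‖ then ‖Wv Φ us z i r‖ ^ 3 else 0) else 0))
        ∂(localGibbsLaw σ a₀ u₀ θ₀ N Φ) ≤
      ENNReal.ofReal (8 * e'' + K ^ 3 * e₃ + e') := by
  haveI := isProbabilityMeasure_localGibbsLaw ha hθ hu ha0 hθ0 hσ2.le N Φ
  have hN : (0 : ℝ) < (N : ℝ) + 1 := by positivity
  have hwN : 0 < w * ((N : ℝ) + 1) := mul_pos hw hN
  have hK0 : 0 ≤ K := by rw [hK]; linarith
  have hgood := ae_mem_good_localGibbsLaw σ a₀ θ₀ u₀ N Φ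
  have hgood' : (localGibbsLaw σ a₀ u₀ θ₀ N Φ) Φ.goodᶜ = 0 := mem_ae_iff.1 hgood
  -- the two measurable window functionals
  have hVm : AEMeasurable (fun z => ∫ r in s..(s + w), tailSum N M (Φ.flow r z)) (localGibbsLaw σ a₀ u₀ θ₀ N Φ) :=
    Φ.aemeasurable_intervalIntegral_comp_flow_torus (f := tailSum N M) (measurable_tailSum N M) s (s + w) hgood'
  have hTm : AEMeasurable (fun z => ∫ r in s..(s + w), ∑ i : Fin (N + 1),
      (if DriftBad κ r₀ D₀ us (Φ.flow r z) i then (1 : ℝ) else 0)) (localGibbsLaw σ a₀ u₀ θ₀ N Φ) :=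
    Φ.aemeasurable_intervalIntegral_comp_flow_torus
      (f := fun c => ∑ i : Fin (N + 1), (if DriftBad κ r₀ D₀ us c i then (1 : ℝ) else 0))
      (Finset.measurable_sum _ fun i _ =>
        Measurable.ite (measurableSet_driftBad κ r₀ D₀ hus i) measurable_const measurable_const) s (s + w) hgood'
  -- their means
  have hV : ∫⁻ z, ENNReal.ofReal (∫ r in s..(s + w), tailSum N M (Φ.flow r z)) ∂(localGibbsLaw σ a₀ u₀ θ₀ N Φ) ≤
      ENNReal.ofReal (w * ((N : ℝ) + 1) * e'') :=
    cubicTailWindow σ N Φ a₀ θ₀ u₀ M e'' s w hσ hσ2 ha hθ hu ha0 hθ0 he'' hw.le hECT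
  have hT := driftCount_window_le hσ2.le ha hθ hu ha0 hθ0 Φ hus hw.le hDB
  -- nonnegativity of the target functional
  have hX0 : ∀ z, 0 ≤ ((N : ℝ) + 1)⁻¹ * ∑ i : Fin (N + 1), (if coh i z then
      w⁻¹ * ∫ r in s..(s + w), (if 1 < ‖Wv Φ us z i r‖ then ‖Wv Φ us z i r‖ ^ 3 else 0) else 0) := by
    intro z
    refine mul_nonneg (inv_nonneg.2 hN.le) (Finset.sum_nonneg fun i _ => ?_)
    split_ifs
    · exact mul_nonneg (inv_nonneg.2 hw.le)
        (intervalIntegral.integral_nonneg (by linarith) fun r _ => by split_ifs <;> positivity)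
    · exact le_rfl
  -- the pathwise bound, a.s.
  have hpath : ∀ᵐ z ∂(localGibbsLaw σ a₀ u₀ θ₀ N Φ),
      |((N : ℝ) + 1)⁻¹ * ∑ i : Fin (N + 1), (if coh i z then
        w⁻¹ * ∫ r in s..(s + w), (if 1 < ‖Wv Φ us z i r‖ then ‖Wv Φ us z i r‖ ^ 3 else 0) else 0)| ≤
      8 * (w * ((N : ℝ) + 1))⁻¹ * (∫ r in s..(s + w), tailSum N M (Φ.flow r z)) + 0 +
        K ^ 3 * (w * ((N : ℝ) + 1))⁻¹ *
          (∫ r in s..(s + w), ∑ i : Fin (N + 1), (if DriftBad κ r₀ D₀ us (Φ.flow r z) i then (1 : ℝ) else 0)) +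
        1 * (((N : ℝ) + 1)⁻¹ * ∑ i : Fin (N + 1), (if coh i z then
          w⁻¹ * ∫ r in s..(s + w), (if 1 < ‖Wv Φ us z i r‖ ∧ ‖Wv Φ us z i r‖ ≤ K ∧ ¬ DriftBad κ r₀ D₀ us (Φ.flow r z) i
            then ‖Wv Φ us z i r‖ ^ 3 else 0) else 0)) := by
    filter_upwards [hgood] with z hz
    rw [abs_of_nonneg (hX0 z), add_zero, one_mul]
    exact pathwise_window_bound Φ hz hus hU hule hUM hK hw (fun i => coh i z)
  have hmain := lintegral_abs_le_of_pathwise (P := localGibbsLaw σ a₀ u₀ θ₀ N Φ)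
    (k₁ := 8 * (w * ((N : ℝ) + 1))⁻¹) (k₀ := 0) (k₃ := K ^ 3 * (w * ((N : ℝ) + 1))⁻¹) (k₂ := 1)
    (by positivity) le_rfl (by positivity) zero_le_one (by positivity) (by positivity) he' hVm hTm hpath hV hT hB
  have e1 : ∀ z, ENNReal.ofReal (((N : ℝ) + 1)⁻¹ * ∑ i : Fin (N + 1), (if coh i z then
      w⁻¹ * ∫ r in s..(s + w), (if 1 < ‖Wv Φ us z i r‖ then ‖Wv Φ us z i r‖ ^ 3 else 0) else 0)) =
      ENNReal.ofReal |((N : ℝ) + 1)⁻¹ * ∑ i : Fin (N + 1), (if coh i z then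
        w⁻¹ * ∫ r in s..(s + w), (if 1 < ‖Wv Φ us z i r‖ then ‖Wv Φ us z i r‖ ^ 3 else 0) else 0)| := fun z => by
    rw [abs_of_nonneg (hX0 z)]
  simp_rw [e1]
  refine hmain.trans (le_of_eq ?_)
  congr 1
  field_simp
  ring

end Summit.AtomisticToContinuum.HydrodynamicLimit.Theorems.ClampedTransferDockBridge

end
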